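import Mathlib
import Summits.NavierStokesRegularity.NavierStokesRegularity.Theorems.WakeRatchetTailRatchetQuietPastFrames
import Summits.NavierStokesRegularity.NavierStokesRegularity.Theorems.WakeRatchetExtractionLaw
import HarnessLib

/-!
# `WakeRatchet.TailRatchet` (stmt-NavierStokesRegularity-21808) — hypothesis class of the tail ratchets:
# every non-trivial member has a NON-TRIVIAL ANCIENT α-LIMIT solving the lattice (Arzelà–Ascoli on the loud frames)

Support file (route `WakeRatchet`; MODEL lattice ODEs of Tao 2016 §4 / §6.4 — nothing here concerns the Navier–Stokes
equations; no item is closed).  Ninth file of the `WakeRatchetQuietPast` series: the extraction that the frame sequences of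
`…QuietPastFrames` were made for, using the tree's abstract Ascoli lemma
`MinimalBlowupExtraction.Extraction.exists_subseq_continuousLimit_param` and its field vocabulary `ClockedFrames.vfield`.

For a non-trivial uniformly bounded (`‖W_j‖ ≤ C`) admissible eternal solution `W` of a table `α` (m = 4) with covariant
viscosity `ν̂ ≥ 0` (`K > 0` a bound of `C_Q + Λ C_A + Λ⁻¹ C_B`), the frames `W^{(j)}_n(u) = W_{n+k_j}(u + s_j)` at the loud
far-past points of `exists_loud_frames` (`s_j ≤ −j`, amplitude `> 1/(64K)` at the origin, viscosity parameters
`ν_j = ν̂(1+ε₀)^{2k_j}e^{−s_j} < V⋆ := (4KC³+1)(64K)²`) solve the SAME renormalised lattice with parameter `ν_j`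
(`frame_hasDerivAt`), are uniformly bounded and equi-Lipschitz on every half-line (`frame_lipschitz`); hence

* `exists_alpha_limit` — **along a subsequence they converge (continuously, shell-wise) to `W∞ : ℤ → ℝ → Em 4` and `ν_j → ν∞ ∈
  [0, V⋆]`, where `W∞` solves the renormalised lattice of `α` with covariant viscosity parameter `ν∞`
  (`HasDerivAt (W∞ n) (vfield ε₀ α ν∞ W∞ n σ) σ`, i.e. the `law` clause of `IsEternalVisc ε₀ ν∞ α W∞`), is bounded by `C`,
  and is NON-TRIVIAL: `‖W∞_0(0)‖ ≥ 1/(64K)`.**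

CAVEAT (honest): the limit inherits the law and the uniform bound; the ACTION clause also passes (Fatou; not recorded here) but
the `bdd` clause of the cell's admissibility (`e^{2σ}‖W_n(σ)‖²` bounded on right half-lines) is NOT inherited in general (the
frame constants scale like `e^{−2s_j}`), so `W∞` is an ancient bounded solution, not automatically a member of the admissible
class — α-limits do not feed the DSS / surviving kill criteria of stmt-21808 directly.

HONEST FRAMING: no stub, crux, rung or summit is proved (stmt-21808 stays dead modulo `WakeRatchetDyadicFront.DyadicScalarFronts`).
-/

noncomputable section

set_option linter.dupNamespace false

namespace Summit.NavierStokesRegularity.NavierStokesRegularity.Theorems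

namespace WakeRatchetQuietPast

open Set Filter Topology MeasureTheory
open Literature.Analysis.FluidPDE Literature.Analysis.FluidPDE.TaoCascade
open Summit.NavierStokesRegularity.NavierStokesRegularity.Cruxes.MinimalBlowupExtraction.Extraction
  (exists_subseq_continuousLimit_param)
open Summit.NavierStokesRegularity.NavierStokesRegularity.Cruxes.MinimalBlowupExtraction.ClockedFrames
  (vfield continuous_vfield_limit)
open Summit.NavierStokesRegularity.NavierStokesRegularity.Cruxes.MinimalBlowupExtraction.TableCont

variable {ε₀ νh : ℝ} {α : Fin 4 → Fin 4 → Fin 4 → ℤ × ℤ × ℤ → ℝ} {W : ℤ → ℝ → Em 4}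

/-! ## Frames of an eternal solution solve the same lattice -/

/-- **Frame law.**  The frame `u ↦ W_{n+k}(u + s)` solves the renormalised lattice with covariant viscosity parameter
`ν̂ (1+ε₀)^{2k} e^{−s}` (shell shift by `k`, log-time shift by `s`).
[cite: Tao2016AveragedNS, §4 Lemma 4.1 (4.8) with the viscous equation before Thm. 4.2, §6.4; cell lemma] -/
theorem frame_hasDerivAt (hε : -1 < ε₀) (hW : IsEternalVisc ε₀ νh α W) (k : ℤ) (s : ℝ) (n : ℤ) (u : ℝ) :
    HasDerivAt (fun v => W (n + k) (v + s))
      (vfield ε₀ α (νh * ((1 + ε₀) ^ ((2 : ℝ) * k) * Real.exp (-s))) (fun m w => W (m + k) (w + s)) n u) u := by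
  have h := (hW.law (n + k) (u + s)).comp_add_const u s
  refine h.congr_deriv ?_
  have hb : (0 : ℝ) < 1 + ε₀ := by linarith
  have e1 : W (n + k - 1) = W (n - 1 + k) := by congr 1; ring
  have e2 : W (n + k + 1) = W (n + 1 + k) := by congr 1; ring
  have e3 : νh * ((1 + ε₀) ^ ((2 : ℝ) * ((n + k : ℤ) : ℝ)) * Real.exp (-(u + s)))
      = νh * ((1 + ε₀) ^ ((2 : ℝ) * k) * Real.exp (-s)) * ((1 + ε₀) ^ ((2 : ℝ) * n) * Real.exp (-u)) := by
    push_cast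
    rw [show (2 : ℝ) * (n + k) = 2 * n + 2 * k by ring, Real.rpow_add hb, neg_add, Real.exp_add]
    ring
  unfold vfield
  rw [e1, e2, e3]

/-- Norm bound for the field: `‖vfield(p, V)_n(u)‖ ≤ C + K C² + p (1+ε₀)^{2n} e^{−u} C` when `‖V‖ ≤ C`, `p ≥ 0`.
[cite: Tao2016AveragedNS, §4 (4.1), Lemma 4.1 (4.8); cell lemma] -/
theorem norm_vfield_le (hε : -1 < ε₀) {K C p : ℝ}
    (hK : shiftConst α (0, 0, 0) + bigLam ε₀ * shiftConst α (0, 0, 1)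
      + (bigLam ε₀)⁻¹ * (shiftConst α (1, 0, 0) + shiftConst α (0, 1, 0)) ≤ K)
    (hC0 : 0 ≤ C) {V : ℤ → ℝ → Em 4} (hV : ∀ (m : ℤ) (w : ℝ), ‖V m w‖ ≤ C) (hp : 0 ≤ p) (n : ℤ) (u : ℝ) :
    ‖vfield ε₀ α p V n u‖ ≤ C + K * C ^ 2 + p * ((1 + ε₀) ^ ((2 : ℝ) * n) * Real.exp (-u)) * C := by
  have hN : ‖tableQ α (V n u) + bigLam ε₀ • tableA α (V (n - 1) u)
      + (bigLam ε₀)⁻¹ • tableB α (V (n + 1) u) (V n u)‖ ≤ K * C ^ 2 :=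
    norm_quad_le_of_bound hε hK hC0 (hV n u) (hV (n - 1) u) (hV (n + 1) u)
  have hq : 0 ≤ p * ((1 + ε₀) ^ ((2 : ℝ) * n) * Real.exp (-u)) :=
    mul_nonneg hp (mul_nonneg (Real.rpow_pos_of_pos (by linarith) _).le (Real.exp_pos _).le)
  unfold vfield
  calc ‖-((1 : ℝ) • V n u) + tableQ α (V n u) + bigLam ε₀ • tableA α (V (n - 1) u)
        + (bigLam ε₀)⁻¹ • tableB α (V (n + 1) u) (V n u)
        - (p * ((1 + ε₀) ^ ((2 : ℝ) * n) * Real.exp (-u))) • V n u‖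
      = ‖-((1 : ℝ) • V n u) + (tableQ α (V n u) + bigLam ε₀ • tableA α (V (n - 1) u)
        + (bigLam ε₀)⁻¹ • tableB α (V (n + 1) u) (V n u))
        - (p * ((1 + ε₀) ^ ((2 : ℝ) * n) * Real.exp (-u))) • V n u‖ := by congr 1; abel
    _ ≤ ‖-((1 : ℝ) • V n u)‖ + ‖tableQ α (V n u) + bigLam ε₀ • tableA α (V (n - 1) u)
        + (bigLam ε₀)⁻¹ • tableB α (V (n + 1) u) (V n u)‖
        + ‖(p * ((1 + ε₀) ^ ((2 : ℝ) * n) * Real.exp (-u))) • V n u‖ :=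
        (norm_sub_le _ _).trans (add_le_add (norm_add_le _ _) le_rfl)
    _ ≤ C + K * C ^ 2 + p * ((1 + ε₀) ^ ((2 : ℝ) * n) * Real.exp (-u)) * C := by
        rw [norm_neg, one_smul, norm_smul, Real.norm_of_nonneg hq]
        exact add_le_add (add_le_add (hV n u) hN) (mul_le_mul_of_nonneg_left (hV n u) hq)

/-- **Frames are equi-Lipschitz on half-lines.**  If `‖W_j‖ ≤ C` and the frame's viscosity parameter
`p = ν̂(1+ε₀)^{2k}e^{−s}` is at most `P`, then on `[a, ∞)` the frame `u ↦ W_{n+k}(u+s)` is Lipschitz with constant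
`C + KC² + P (1+ε₀)^{2n} e^{−a} C`. [cite: Tao2016AveragedNS, §4 Lemma 4.1 (4.8), §6.4; cell lemma] -/
theorem frame_lipschitz (hε : -1 < ε₀) (hW : IsEternalVisc ε₀ νh α W) {K C P : ℝ}
    (hK : shiftConst α (0, 0, 0) + bigLam ε₀ * shiftConst α (0, 0, 1)
      + (bigLam ε₀)⁻¹ * (shiftConst α (1, 0, 0) + shiftConst α (0, 1, 0)) ≤ K)
    (hC0 : 0 ≤ C) (hC : ∀ (j : ℤ) (σ : ℝ), ‖W j σ‖ ≤ C) (k : ℤ) (s : ℝ)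
    (hP : νh * ((1 + ε₀) ^ ((2 : ℝ) * k) * Real.exp (-s)) ≤ P) (n : ℤ) (a : ℝ) {u v : ℝ} (hu : a ≤ u) (hv : a ≤ v) :
    ‖W (n + k) (u + s) - W (n + k) (v + s)‖ ≤
      (C + K * C ^ 2 + P * ((1 + ε₀) ^ ((2 : ℝ) * n) * Real.exp (-a)) * C) * |u - v| := by
  set p : ℝ := νh * ((1 + ε₀) ^ ((2 : ℝ) * k) * Real.exp (-s)) with hp
  have hp0 : 0 ≤ p := mul_nonneg hW.nonneg (mul_nonneg (Real.rpow_pos_of_pos (by linarith) _).le (Real.exp_pos _).le)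
  have hb : 0 < (1 + ε₀) ^ ((2 : ℝ) * n) := Real.rpow_pos_of_pos (by linarith) _
  have hbound : ∀ x ∈ Ici a, ‖vfield ε₀ α p (fun m w => W (m + k) (w + s)) n x‖ ≤
      C + K * C ^ 2 + P * ((1 + ε₀) ^ ((2 : ℝ) * n) * Real.exp (-a)) * C := by
    intro x hx
    refine (norm_vfield_le hε hK hC0 (fun m w => hC (m + k) (w + s)) hp0 n x).trans ?_
    have hex : Real.exp (-x) ≤ Real.exp (-a) := Real.exp_le_exp.2 (by have := mem_Ici.1 hx; linarith)
    have h1 : p * ((1 + ε₀) ^ ((2 : ℝ) * n) * Real.exp (-x)) ≤ P * ((1 + ε₀) ^ ((2 : ℝ) * n) * Real.exp (-a)) :=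
      mul_le_mul hP (mul_le_mul_of_nonneg_left hex hb.le) (by positivity) (hp0.trans hP)
    nlinarith [mul_le_mul_of_nonneg_right h1 hC0]
  have h := (convex_Ici a).norm_image_sub_le_of_norm_hasDerivWithin_le
    (f := fun w => W (n + k) (w + s))
    (fun x _ => (frame_hasDerivAt hε hW k s n x).hasDerivWithinAt) hbound hv hu
  simpa [Real.norm_eq_abs] using h

/-! ## The α-limit -/

/-- **Non-trivial ancient α-limit.**  A non-trivial uniformly bounded (`‖W_j‖ ≤ C`) admissible eternal solution of a table `α`
(m = 4) with covariant viscosity `ν̂ ≥ 0` has frames at loud far-past points (`s_j ≤ −j`) converging, along a subsequence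
and continuously in log-time at every shell, to a solution `W∞` of the renormalised lattice of `α` with a covariant viscosity
parameter `ν∞ ∈ [0, (4KC³+1)(64K)²]`, bounded by `C`, with `‖W∞_0(0)‖ ≥ 1/(64K)`.
[cite: Tao2016AveragedNS, §4 Lemma 4.1 (4.8), §6.4; cell theorem (Arzelà–Ascoli: tree `exists_subseq_continuousLimit_param`)] -/
theorem exists_alpha_limit (hε : -1 < ε₀) (hW : IsEternalVisc ε₀ νh α W) {K C : ℝ}
    (hK : shiftConst α (0, 0, 0) + bigLam ε₀ * shiftConst α (0, 0, 1)
      + (bigLam ε₀)⁻¹ * (shiftConst α (1, 0, 0) + shiftConst α (0, 1, 0)) ≤ K)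
    (hK0 : 0 < K) (hC0 : 0 ≤ C) (hC : ∀ (j : ℤ) (σ : ℝ), ‖W j σ‖ ≤ C) (hne : ∃ (n : ℤ) (σ : ℝ), W n σ ≠ 0) :
    ∃ (k : ℕ → ℤ) (s : ℕ → ℝ) (φ : ℕ → ℕ) (νinf : ℝ) (Winf : ℤ → ℝ → Em 4),
      StrictMono φ ∧ (∀ j, s j ≤ -(j : ℝ)) ∧
      νinf ∈ Icc 0 ((4 * K * C ^ 3 + 1) * (64 * K) ^ 2) ∧
      Tendsto (fun j => νh * ((1 + ε₀) ^ ((2 : ℝ) * (k (φ j))) * Real.exp (-(s (φ j))))) atTop (𝓝 νinf) ∧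
      (∀ (n : ℤ) (u : ℕ → ℝ) (σ : ℝ), Tendsto u atTop (𝓝 σ) →
        Tendsto (fun j => W (n + k (φ j)) (u j + s (φ j))) atTop (𝓝 (Winf n σ))) ∧
      (∀ (n : ℤ) (σ : ℝ), HasDerivAt (Winf n) (vfield ε₀ α νinf Winf n σ) σ) ∧
      (∀ (n : ℤ) (σ : ℝ), ‖Winf n σ‖ ≤ C) ∧
      1 / (64 * K) ≤ ‖Winf 0 0‖ := by
  obtain ⟨k, s, hs, -, hloud⟩ := exists_loud_frames hε hW hK hK0 hC0 hC hne
  set V : ℝ := (4 * K * C ^ 3 + 1) * (64 * K) ^ 2 with hV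
  -- frames and their viscosity parameters
  set g : ℕ → ℤ → ℝ → Em 4 := fun j n u => W (n + k j) (u + s j) with hg
  set r : ℕ → ℝ := fun j => νh * ((1 + ε₀) ^ ((2 : ℝ) * (k j)) * Real.exp (-(s j))) with hr
  have hr0 : ∀ j, 0 ≤ r j := fun j =>
    mul_nonneg hW.nonneg (mul_nonneg (Real.rpow_pos_of_pos (by linarith) _).le (Real.exp_pos _).le)
  have hrV : ∀ j, r j ∈ Icc 0 V := fun j => ⟨hr0 j, (hloud j).2.le⟩
  -- Ascoli hypotheses
  have hB : ∀ (n : ℤ) (a : ℝ), ∃ C' : ℝ, ∃ J : ℕ, ∀ j, J ≤ j → ∀ u : ℝ, a ≤ u → ‖g j n u‖ ≤ C' :=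
    fun n a => ⟨C, 0, fun j _ u _ => hC _ _⟩
  have hL : ∀ (n : ℤ) (a : ℝ), ∃ L : ℝ, ∃ J : ℕ, ∀ j, J ≤ j → ∀ u v : ℝ, a ≤ u → a ≤ v →
      ‖g j n u - g j n v‖ ≤ L * |u - v| :=
    fun n a => ⟨C + K * C ^ 2 + V * ((1 + ε₀) ^ ((2 : ℝ) * n) * Real.exp (-a)) * C, 0,
      fun j _ u v hu hv => frame_lipschitz hε hW hK hC0 hC (k j) (s j) (hloud j).2.le n a hu hv⟩
  obtain ⟨φ, hφ, ⟨νinf, hνinf, hrlim⟩, Winf, hconv⟩ := exists_subseq_continuousLimit_param g hB hL r 0 V hrV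
  have hpt : ∀ (n : ℤ) (σ : ℝ), Tendsto (fun j => g (φ j) n σ) atTop (𝓝 (Winf n σ)) :=
    fun n σ => hconv n (fun _ => σ) σ tendsto_const_nhds
  -- bound and non-triviality of the limit
  have hWb : ∀ (n : ℤ) (σ : ℝ), ‖Winf n σ‖ ≤ C :=
    fun n σ => le_of_tendsto (hpt n σ).norm (Eventually.of_forall fun j => hC _ _)
  have hW0 : 1 / (64 * K) ≤ ‖Winf 0 0‖ := by
    refine ge_of_tendsto (hpt 0 0).norm (Eventually.of_forall fun j => ?_)
    have := (hloud (φ j)).1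
    simp only [hg, zero_add] at this ⊢
    exact this.le
  -- Lipschitz (hence continuity) of the limit on half-lines
  have hWlip : ∀ (n : ℤ) (a : ℝ) (u v : ℝ), a ≤ u → a ≤ v →
      ‖Winf n u - Winf n v‖ ≤ (C + K * C ^ 2 + V * ((1 + ε₀) ^ ((2 : ℝ) * n) * Real.exp (-a)) * C) * |u - v| := by
    intro n a u v hu hv
    refine le_of_tendsto ((hpt n u).sub (hpt n v)).norm (Eventually.of_forall fun j => ?_)
    exact frame_lipschitz hε hW hK hC0 hC (k (φ j)) (s (φ j)) (hloud (φ j)).2.le n a hu hv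
  have hWc : ∀ n : ℤ, Continuous (Winf n) := by
    intro n
    refine continuous_iff_continuousAt.2 fun σ => ?_
    have hlipOn : LipschitzOnWith
        (Real.toNNReal (C + K * C ^ 2 + V * ((1 + ε₀) ^ ((2 : ℝ) * n) * Real.exp (-(σ - 1))) * C))
        (Winf n) (Ici (σ - 1)) := by
      refine LipschitzOnWith.of_dist_le_mul fun u hu v hv => ?_
      rw [dist_eq_norm, dist_eq_norm, Real.norm_eq_abs]
      have h := hWlip n (σ - 1) u v hu hv
      refine h.trans (mul_le_mul_of_nonneg_right (Real.le_coe_toNNReal _) (abs_nonneg _))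
    exact hlipOn.continuousOn.continuousAt (Ici_mem_nhds (by linarith))
  -- the field converges pointwise along the frames
  have hfield : ∀ (n : ℤ) (u : ℝ), Tendsto (fun j => vfield ε₀ α (r (φ j)) (g (φ j)) n u) atTop
      (𝓝 (vfield ε₀ α νinf Winf n u)) := by
    intro n u
    have hQ := tendsto_tableQ_comp α (hpt n u)
    have hA := tendsto_tableA_comp α (hpt (n - 1) u)
    have hBB := tendsto_tableB_comp α (hpt (n + 1) u) (hpt n u)
    have hsc : Tendsto (fun j => r (φ j) * ((1 + ε₀) ^ ((2 : ℝ) * n) * Real.exp (-u))) atTop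
        (𝓝 (νinf * ((1 + ε₀) ^ ((2 : ℝ) * n) * Real.exp (-u)))) := hrlim.mul_const _
    unfold vfield
    refine Tendsto.sub (Tendsto.add (Tendsto.add (Tendsto.add ?_ hQ) ?_) ?_) ?_
    · exact Tendsto.neg (Tendsto.const_smul (hpt n u) (1 : ℝ))
    · exact Tendsto.const_smul hA (bigLam ε₀)
    · exact Tendsto.const_smul hBB ((bigLam ε₀)⁻¹)
    · exact Tendsto.smul hsc (hpt n u)
  -- integral form of the limit on `[σ₀, σ]`
  have hint : ∀ (n : ℤ) (σ₀ σ : ℝ), σ₀ ≤ σ →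
      ∫ u in σ₀..σ, vfield ε₀ α νinf Winf n u = Winf n σ - Winf n σ₀ := by
    intro n σ₀ σ hσ
    -- each frame: FTC
    have hframe : ∀ j : ℕ, ∫ u in σ₀..σ, vfield ε₀ α (r (φ j)) (g (φ j)) n u = g (φ j) n σ - g (φ j) n σ₀ := by
      intro j
      refine intervalIntegral.integral_eq_sub_of_hasDerivAt (fun u _ => ?_) ?_
      · exact frame_hasDerivAt hε hW (k (φ j)) (s (φ j)) n u
      · refine ContinuousOn.intervalIntegrable ?_
        have hcg : ∀ m : ℤ, Continuous (g (φ j) m) := fun m =>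
          continuous_iff_continuousAt.2 fun x => (frame_hasDerivAt hε hW (k (φ j)) (s (φ j)) m x).continuousAt
        exact (continuous_vfield_limit hcg (r (φ j)) n).continuousOn
    -- dominated convergence with a constant bound
    set L : ℝ := C + K * C ^ 2 + V * ((1 + ε₀) ^ ((2 : ℝ) * n) * Real.exp (-σ₀)) * C with hLdef
    have hdom : Tendsto (fun j => ∫ u in σ₀..σ, vfield ε₀ α (r (φ j)) (g (φ j)) n u) atTop
        (𝓝 (∫ u in σ₀..σ, vfield ε₀ α νinf Winf n u)) := by
      refine intervalIntegral.tendsto_integral_filter_of_dominated_convergence (fun _ => L) ?_ ?_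
        intervalIntegrable_const ?_
      · refine Eventually.of_forall fun j => Continuous.aestronglyMeasurable ?_
        have hcg : ∀ m : ℤ, Continuous (g (φ j) m) := fun m =>
          continuous_iff_continuousAt.2 fun x => (frame_hasDerivAt hε hW (k (φ j)) (s (φ j)) m x).continuousAt
        exact continuous_vfield_limit hcg (r (φ j)) n
      · refine Eventually.of_forall fun j => ae_of_all _ fun u hu => ?_
        rw [Set.uIoc_of_le hσ] at hu
        have hb : 0 < (1 + ε₀) ^ ((2 : ℝ) * n) := Real.rpow_pos_of_pos (by linarith) _
        refine (norm_vfield_le hε hK hC0 (fun m w => hC (m + k (φ j)) (w + s (φ j))) (hr0 (φ j)) n u).trans ?_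
        have hex : Real.exp (-u) ≤ Real.exp (-σ₀) := Real.exp_le_exp.2 (by linarith [hu.1])
        have h1 : r (φ j) * ((1 + ε₀) ^ ((2 : ℝ) * n) * Real.exp (-u))
            ≤ V * ((1 + ε₀) ^ ((2 : ℝ) * n) * Real.exp (-σ₀)) :=
          mul_le_mul (hrV (φ j)).2 (mul_le_mul_of_nonneg_left hex hb.le) (by positivity)
            ((hr0 (φ j)).trans (hrV (φ j)).2)
        rw [hLdef]
        nlinarith [mul_le_mul_of_nonneg_right h1 hC0]
      · exact ae_of_all _ fun u _ => hfield n u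
    have hdom' : Tendsto (fun j => g (φ j) n σ - g (φ j) n σ₀) atTop
        (𝓝 (∫ u in σ₀..σ, vfield ε₀ α νinf Winf n u)) :=
      hdom.congr fun j => hframe j
    exact tendsto_nhds_unique hdom' ((hpt n σ).sub (hpt n σ₀))
  -- differentiate the integral identity
  have hlaw : ∀ (n : ℤ) (σ : ℝ), HasDerivAt (Winf n) (vfield ε₀ α νinf Winf n σ) σ := by
    intro n σ
    have hΦ : Continuous (fun u => vfield ε₀ α νinf Winf n u) := continuous_vfield_limit hWc νinf n
    have hG : HasDerivAt (fun t => Winf n (σ - 1) + ∫ u in (σ - 1)..t, vfield ε₀ α νinf Winf n u)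
        (vfield ε₀ α νinf Winf n σ) σ := by
      have h := intervalIntegral.integral_hasDerivAt_right (hΦ.intervalIntegrable _ _)
        (hΦ.stronglyMeasurableAtFilter _ _) hΦ.continuousAt (a := σ - 1) (b := σ)
      exact h.const_add _
    have heq : Winf n =ᶠ[𝓝 σ] fun t => Winf n (σ - 1) + ∫ u in (σ - 1)..t, vfield ε₀ α νinf Winf n u := by
      filter_upwards [Ici_mem_nhds (show σ - 1 < σ by linarith)] with t ht
      rw [hint n (σ - 1) t ht]
      abel
    exact hG.congr_of_eventuallyEq heq
  refine ⟨k, s, φ, νinf, Winf, hφ, hs, hνinf, hrlim, ?_, hlaw, hWb, hW0⟩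
  intro n u σ hu
  exact hconv n u σ hu

end WakeRatchetQuietPast

end Summit.NavierStokesRegularity.NavierStokesRegularity.Theorems

end
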